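import Summits.HubbardSuperconductivity.HubbardSuperconductivity.Theorems.AnisotropyChordTransferFibre3FinXDCheck

/-!
# Route `AnisotropyChord` / H0 rotor rung: FIN per-`L` row-D (KT-2a″) cell facts, `L = 9`, cells 24–29

Kernel facts `xdCellAny0 9 (49/50) la lb aD = true` (in-kernel point tables, zero data; `decide +kernel`) for the combined-cell
grid of `L = 9` (g5 design, 1–2.5 % cells); assembled in `…FinXDNine`.  Prover seat `hubbard-h0-rotor-p3` g7; helper for piece A =
stmt-HubbardSuperconductivity-23918 of rung 19089 (`--supports`, helper class).  WHAT THIS IS NOT: nothing here proves superconductivity in the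
Hubbard model (rotor TARGET as worded stays FALSE, g15 verdict); kernel facts for ONE hypothesis of ONE conditional reduction.  No sorry.
-/

set_option linter.dupNamespace false
set_option autoImplicit false

namespace Summit.HubbardSuperconductivity.HubbardSuperconductivity.Theorems.AnisotropyChord.Transfer.Fibre3

namespace FinXD

/-- cell 24 of `L = 9` (`cert`). [folklore] -/
theorem xd9_24 : xdCellAny0 9 (49/50 : ℚ) 1255070070759137 1286446822528116 (7/100 : ℚ) = true := by decide +kernel

/-- cell 25 of `L = 9` (`cert`). [folklore] -/
theorem xd9_25 : xdCellAny0 9 (49/50 : ℚ) 1286446822528116 1318607993091319 (7/100 : ℚ) = true := by decide +kernel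

/-- cell 26 of `L = 9` (`cert`). [folklore] -/
theorem xd9_26 : xdCellAny0 9 (49/50 : ℚ) 1318607993091319 1351573192918602 (7/100 : ℚ) = true := by decide +kernel

/-- cell 27 of `L = 9` (`cert`). [folklore] -/
theorem xd9_27 : xdCellAny0 9 (49/50 : ℚ) 1351573192918602 1385362522741568 (3/50 : ℚ) = true := by decide +kernel

/-- cell 28 of `L = 9` (`cert`). [folklore] -/
theorem xd9_28 : xdCellAny0 9 (49/50 : ℚ) 1385362522741568 1419996585810108 (3/50 : ℚ) = true := by decide +kernel

/-- cell 29 of `L = 9` (`cert`). [folklore] -/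
theorem xd9_29 : xdCellAny0 9 (49/50 : ℚ) 1419996585810108 1455496500455361 (3/50 : ℚ) = true := by decide +kernel

end FinXD

end Summit.HubbardSuperconductivity.HubbardSuperconductivity.Theorems.AnisotropyChord.Transfer.Fibre3
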